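import Summits.AtomisticToContinuum.Crystallization.Theorems.SquareWellLayerCakeGapTwelveToBarlowFiveRingCensusDefs

/-!
# Five-ring shell census: soundness glue (tuple level and claim level)

Crux `SquareWellLayerCake.GapTwelveToBarlow` (stmt-AtomisticToContinuum-15807), line `Sketch`,
stubs `stub_fiveFoldExists` / `stub_fiveFoldNoAdjacent` (S2β).  The interface is
`…FiveRingCensusDefs`: the specification `fiveRingSpec η A` of the gapped-shell census replayer
(`Literature/Geometry/DiscreteGeometry/ShellCensusReplay*.lean`) for the twelve neighbours of a
Good site with the local `131/100` dichotomy, the rational anchors `anchorPatterns η A`, the pole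
constraints `fiveRingConstraints.take 11` (label `0` bonded to `1, …, 5`, far from `6, …, 11`),
the bicapped pentagonal prism `bppAdj` and the decidable forcing test `bppForcingB η A`.

This file is GENERIC in the closeness `η` and the anchor tables `A`:

* `bond_iff_bppAdj_of_close` (**forcing**): an admissible tuple that is `TupleClose η` to an
  anchor row of `A` with `bppForcingB η A = true` has contact graph (pairs at distance `≤ 1`)
  equal to `bppAdj` pulled back along the relabelling — triangle inequality through the isometry
  (`|dist (t k) (t l) − dist (p (σ k)) (p (σ l))| ≤ 2η`), `dist_qpt_sq`, and the admissible
  alternative `≤ 1 ∨ ≥ 131/100`;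
* `card_bonded_eq_of_bond_iff`, `bpp_card_filter`: the contact degrees are the BPP degrees,
  `5` at the two poles `0`, `11` and `4` elsewhere;
* `poles_of_fiveRingClaim` (**claim level**): under the census claim
  `(fiveRingSpec η A).Claim (anchorPatterns η A) (fiveRingConstraints.take 11)` every admissible
  tuple satisfying the pole constraints has a SECOND label of contact degree `5`, and every such
  label is not bonded to label `0`.

Mathlib + `Literature.Geometry.DiscreteGeometry.ShellCensus*` + the Defs file only; no named fact
is used.
-/

noncomputable section

namespace Summit.AtomisticToContinuum.Crystallization.Theorems.SquareWellLayerCakeGapTwelveToBarlow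

open Literature.Geometry.DiscreteGeometry Literature.Geometry.DiscreteGeometry.ShellCensus Finset

/-! ### Unpacking the forcing test -/

/-- The forcing test bounds the closeness: `0 ≤ η` and `2η ≤ 131/100`. -/
theorem forcing_eta {η : ℚ} {A : List (List (ℚ × ℚ × ℚ))} (hF : bppForcingB η A = true) :
    0 ≤ η ∧ 2 * η ≤ 131 / 100 := by
  unfold bppForcingB at hF
  simp only [Bool.and_eq_true, decide_eq_true_eq] at hF
  exact ⟨hF.1.1, hF.1.2⟩

/-- The forcing test, one pair of labels of one anchor row: BPP-adjacent labels are at squared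
distance `< (131/100 − 2η)²`, distinct non-adjacent ones at squared distance `> (1 + 2η)²`. -/
theorem forcing_pair {η : ℚ} {A : List (List (ℚ × ℚ × ℚ))} (hF : bppForcingB η A = true)
    {row : List (ℚ × ℚ × ℚ)} (hrow : row ∈ A) {a b : ℕ} (ha : a < 12) (hb : b < 12)
    (hab : a ≠ b) :
    (bppAdj a b = true → sqDistQ (rowPt row a) (rowPt row b) < (131 / 100 - 2 * η) ^ 2) ∧
      (bppAdj a b = false → (1 + 2 * η) ^ 2 < sqDistQ (rowPt row a) (rowPt row b)) := by
  unfold bppForcingB at hF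
  simp only [Bool.and_eq_true, List.all_eq_true] at hF
  have h := hF.2 row hrow a (List.mem_range.2 ha) b (List.mem_range.2 hb)
  constructor
  · intro hadj
    simpa [hadj, hab] using h
  · intro hadj
    simpa [hadj, hab] using h

/-- Adjacent labels of a forcing anchor row are `< 131/100 − 2η` apart (real distance of the
rational points). -/
theorem dist_anchor_lt_of_adj {η : ℚ} {A : List (List (ℚ × ℚ × ℚ))} (hF : bppForcingB η A = true)
    {row : List (ℚ × ℚ × ℚ)} (hrow : row ∈ A) {a b : ℕ} (ha : a < 12) (hb : b < 12) (hab : a ≠ b)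
    (hadj : bppAdj a b = true) :
    dist (qpt (rowPt row a)) (qpt (rowPt row b)) < 131 / 100 - 2 * (η : ℝ) := by
  have h := (forcing_pair hF hrow ha hb hab).1 hadj
  have hη : (((2 : ℚ) * η : ℚ) : ℝ) ≤ ((131 / 100 : ℚ) : ℝ) := Rat.cast_le.2 (forcing_eta hF).2
  push_cast at hη
  have h' := (Rat.cast_lt (K := ℝ)).2 h
  push_cast at h'
  have hsq : dist (qpt (rowPt row a)) (qpt (rowPt row b)) ^ 2 < (131 / 100 - 2 * (η : ℝ)) ^ 2 := by
    rw [dist_qpt_sq]; exact h'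
  exact lt_of_pow_lt_pow_left₀ 2 (by linarith) hsq

/-- Distinct non-adjacent labels of a forcing anchor row are `> 1 + 2η` apart. -/
theorem lt_dist_anchor_of_not_adj {η : ℚ} {A : List (List (ℚ × ℚ × ℚ))}
    (hF : bppForcingB η A = true) {row : List (ℚ × ℚ × ℚ)} (hrow : row ∈ A) {a b : ℕ}
    (ha : a < 12) (hb : b < 12) (hab : a ≠ b) (hadj : bppAdj a b = false) :
    1 + 2 * (η : ℝ) < dist (qpt (rowPt row a)) (qpt (rowPt row b)) := by
  have h := (Rat.cast_lt (K := ℝ)).2 ((forcing_pair hF hrow ha hb hab).2 hadj)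
  push_cast at h
  have hsq : (1 + 2 * (η : ℝ)) ^ 2 < dist (qpt (rowPt row a)) (qpt (rowPt row b)) ^ 2 := by
    rw [dist_qpt_sq]; exact h
  exact lt_of_pow_lt_pow_left₀ 2 dist_nonneg hsq

/-! ### Forcing: the contact graph of a close admissible tuple is the bicapped pentagonal prism -/

/-- **Forcing.** An admissible tuple of `fiveRingSpec η A` that is `η`-close (after a linear
isometry and a relabelling `σ`) to an anchor row of `A` passing the forcing test has, for distinct
labels `k`, `l`: `dist (t k) (t l) ≤ 1 ↔ bppAdj (σ k) (σ l)`.  Indeed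
`|dist (t k) (t l) − dist (p (σ k)) (p (σ l))| ≤ 2η`, so an adjacent pair is `< 131/100` apart,
hence bonded by the admissible alternative, and a non-adjacent pair is `> 1` apart. -/
theorem bond_iff_bppAdj_of_close {η : ℚ} {A : List (List (ℚ × ℚ × ℚ))}
    (hF : bppForcingB η A = true) {row : List (ℚ × ℚ × ℚ)} (hrow : row ∈ A)
    {t : Fin 12 → EuclideanSpace ℝ (Fin 3)} (ht : (fiveRingSpec η A).Admissible t)
    (hclose : TupleClose (η : ℝ) t (anchorTuple η A row)) :
    ∃ σ : Equiv.Perm (Fin 12), ∀ k l : Fin 12, k ≠ l →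
      (dist (t k) (t l) ≤ 1 ↔ bppAdj (σ k) (σ l) = true) := by
  obtain ⟨B, σ, hσ⟩ := hclose
  refine ⟨σ, fun k l hkl => ?_⟩
  have hne : ((σ k : Fin 12) : ℕ) ≠ (σ l : ℕ) := fun h => hkl (σ.injective (Fin.ext h))
  have hk : dist (t k) (B (qpt (rowPt row (σ k)))) ≤ η := hσ k
  have hl : dist (B (qpt (rowPt row (σ l)))) (t l) ≤ η := by rw [dist_comm]; exact hσ l
  have hiso : dist (B (qpt (rowPt row (σ k)))) (B (qpt (rowPt row (σ l)))) =
      dist (qpt (rowPt row (σ k))) (qpt (rowPt row (σ l))) := B.dist_map _ _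
  have halt : dist (t k) (t l) ≤ ((1 : ℚ) : ℝ) ∨ ((131 / 100 : ℚ) : ℝ) ≤ dist (t k) (t l) :=
    ht.dist_alt k l hkl
  push_cast at halt
  have tri1 := dist_triangle4 (t k) (B (qpt (rowPt row (σ k)))) (B (qpt (rowPt row (σ l)))) (t l)
  have tri2 := dist_triangle4 (B (qpt (rowPt row (σ k)))) (t k) (t l) (B (qpt (rowPt row (σ l))))
  rw [dist_comm (B (qpt (rowPt row (σ k)))) (t k)] at tri2
  rw [dist_comm (t l)] at tri2
  constructor
  · intro hb
    by_contra hadj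
    have hadj' : bppAdj (σ k) (σ l) = false := by simpa using hadj
    have hfar := lt_dist_anchor_of_not_adj hF hrow (σ k).2 (σ l).2 hne hadj'
    linarith
  · intro hadj
    have hnear := dist_anchor_lt_of_adj hF hrow (σ k).2 (σ l).2 hne hadj
    rcases halt with h | h
    · exact h
    · exfalso
      linarith

/-! ### Degrees -/

/-- The BPP degrees: the labels adjacent to `a` (other than `a`) number `5` at the poles `0`,
`11` and `4` at the ring labels. -/
theorem bpp_card_filter (a : Fin 12) :
    (univ.filter fun m : Fin 12 => m ≠ a ∧ bppAdj a m = true).card =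
      if a = 0 ∨ a = 11 then 5 else 4 := by
  revert a
  decide

/-- Two distinct poles are not adjacent (the only poles are `0` and `11`). -/
theorem bpp_poles_not_adj' (a b : Fin 12) (ha : a = 0 ∨ a = 11) (hb : b = 0 ∨ b = 11)
    (hab : a ≠ b) : bppAdj a b = false := by
  revert a b
  decide

/-- **Transport of the contact degree** through the relabelling of the forcing: the number of
labels bonded to `k` is the BPP degree of `σ k`. -/
theorem card_bonded_eq_of_bond_iff {t : Fin 12 → EuclideanSpace ℝ (Fin 3)}
    {σ : Equiv.Perm (Fin 12)}
    (h : ∀ k l : Fin 12, k ≠ l → (dist (t k) (t l) ≤ 1 ↔ bppAdj (σ k) (σ l) = true))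
    (k : Fin 12) :
    (univ.filter fun l : Fin 12 => l ≠ k ∧ dist (t k) (t l) ≤ 1).card =
      (univ.filter fun m : Fin 12 => m ≠ σ k ∧ bppAdj (σ k) m = true).card := by
  have hset : (univ.filter fun l : Fin 12 => l ≠ k ∧ dist (t k) (t l) ≤ 1) =
      (univ.filter fun m : Fin 12 => m ≠ σ k ∧ bppAdj (σ k) m = true).map σ.symm.toEmbedding := by
    ext l
    simp only [mem_filter, mem_univ, true_and, mem_map_equiv, Equiv.symm_symm]
    constructor
    · rintro ⟨hlk, hd⟩
      exact ⟨fun h' => hlk (σ.injective h'), (h k l (Ne.symm hlk)).1 hd⟩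
    · rintro ⟨hlk, hd⟩
      have hlk' : l ≠ k := fun h' => hlk (congrArg σ h')
      exact ⟨hlk', (h k l (Ne.symm hlk')).2 hd⟩
  rw [hset, card_map]

/-- The contact degree of a forced tuple is `4` or `5`, and it is `5` iff the label is sent to a
pole. -/
theorem card_bonded_eq_five_iff {t : Fin 12 → EuclideanSpace ℝ (Fin 3)}
    {σ : Equiv.Perm (Fin 12)}
    (h : ∀ k l : Fin 12, k ≠ l → (dist (t k) (t l) ≤ 1 ↔ bppAdj (σ k) (σ l) = true))
    (k : Fin 12) :
    ((univ.filter fun l : Fin 12 => l ≠ k ∧ dist (t k) (t l) ≤ 1).card = 5 ↔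
        (σ k = 0 ∨ σ k = 11)) ∧
      ((univ.filter fun l : Fin 12 => l ≠ k ∧ dist (t k) (t l) ≤ 1).card = 4 ∨
        (univ.filter fun l : Fin 12 => l ≠ k ∧ dist (t k) (t l) ≤ 1).card = 5) := by
  rw [card_bonded_eq_of_bond_iff h k, bpp_card_filter (σ k)]
  split_ifs with hp
  · simp [hp]
  · simp [hp]

/-! ### The pole constraints -/

/-- The bond constraints of a five-fold pole: under `Sat (fiveRingConstraints.take 11)`, label
`0` is bonded to the ring labels `1, …, 5`. -/
theorem dist_le_one_of_sat {η : ℚ} {A : List (List (ℚ × ℚ × ℚ))}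
    {t : Fin 12 → EuclideanSpace ℝ (Fin 3)}
    (hS : (fiveRingSpec η A).Sat (fiveRingConstraints.take 11) t) (m : Fin 12)
    (h1 : 1 ≤ (m : ℕ)) (h5 : (m : ℕ) ≤ 5) : dist (t 0) (t m) ≤ 1 := by
  have hc : ((0 : ℕ), (m : ℕ), true) ∈ fiveRingConstraints.take 11 := by
    have hm : (m : ℕ) = 1 ∨ (m : ℕ) = 2 ∨ (m : ℕ) = 3 ∨ (m : ℕ) = 4 ∨ (m : ℕ) = 5 := by omega
    rcases hm with hm | hm | hm | hm | hm <;> rw [hm] <;> decide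
  have h := (hS _ hc (show 0 < 12 by norm_num) m.isLt).1 rfl
  have h' : dist (t 0) (t m) ≤ ((1 : ℚ) : ℝ) := h
  simpa using h'

/-- The far constraints of a five-fold pole: under `Sat (fiveRingConstraints.take 11)`, label
`0` is at distance `≥ 131/100` from the labels `6, …, 11`. -/
theorem le_dist_of_sat {η : ℚ} {A : List (List (ℚ × ℚ × ℚ))}
    {t : Fin 12 → EuclideanSpace ℝ (Fin 3)}
    (hS : (fiveRingSpec η A).Sat (fiveRingConstraints.take 11) t) (m : Fin 12)
    (h6 : 6 ≤ (m : ℕ)) : (131 : ℝ) / 100 ≤ dist (t 0) (t m) := by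
  have hc : ((0 : ℕ), (m : ℕ), false) ∈ fiveRingConstraints.take 11 := by
    have hm : (m : ℕ) = 6 ∨ (m : ℕ) = 7 ∨ (m : ℕ) = 8 ∨ (m : ℕ) = 9 ∨ (m : ℕ) = 10 ∨
        (m : ℕ) = 11 := by
      have := m.isLt; omega
    rcases hm with hm | hm | hm | hm | hm | hm <;> rw [hm] <;> decide
  have h := (hS _ hc (show 0 < 12 by norm_num) m.isLt).2 rfl
  have h' : ((131 / 100 : ℚ) : ℝ) ≤ dist (t 0) (t m) := h
  push_cast at h'
  exact h'

/-- Conversely, a tuple with these eleven bond / far relations satisfies the pole constraints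
`fiveRingConstraints.take 11`. -/
theorem sat_take_of_bond_far {η : ℚ} {A : List (List (ℚ × ℚ × ℚ))}
    {t : Fin 12 → EuclideanSpace ℝ (Fin 3)}
    (hb : ∀ m : Fin 12, 1 ≤ (m : ℕ) → (m : ℕ) ≤ 5 → dist (t 0) (t m) ≤ 1)
    (hf : ∀ m : Fin 12, 6 ≤ (m : ℕ) → (131 : ℝ) / 100 ≤ dist (t 0) (t m)) :
    (fiveRingSpec η A).Sat (fiveRingConstraints.take 11) t := by
  intro c hc hk hl
  have hdhi : (((fiveRingSpec η A).dhi : ℚ) : ℝ) = 1 := by simp [fiveRingSpec]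
  have hgap : (((fiveRingSpec η A).gap : ℚ) : ℝ) = 131 / 100 := by norm_num [fiveRingSpec]
  rw [hdhi, hgap]
  simp only [fiveRingConstraints, List.take_succ_cons, List.take_zero, List.mem_cons,
    List.not_mem_nil, or_false] at hc
  rcases hc with rfl | rfl | rfl | rfl | rfl | rfl | rfl | rfl | rfl | rfl | rfl
  · exact ⟨fun _ => hb ⟨1, by norm_num⟩ (by norm_num) (by norm_num), fun h => absurd h (by decide)⟩
  · exact ⟨fun _ => hb ⟨2, by norm_num⟩ (by norm_num) (by norm_num), fun h => absurd h (by decide)⟩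
  · exact ⟨fun _ => hb ⟨3, by norm_num⟩ (by norm_num) (by norm_num), fun h => absurd h (by decide)⟩
  · exact ⟨fun _ => hb ⟨4, by norm_num⟩ (by norm_num) (by norm_num), fun h => absurd h (by decide)⟩
  · exact ⟨fun _ => hb ⟨5, by norm_num⟩ (by norm_num) (by norm_num), fun h => absurd h (by decide)⟩
  · exact ⟨fun h => absurd h (by decide), fun _ => hf ⟨6, by norm_num⟩ (by norm_num)⟩
  · exact ⟨fun h => absurd h (by decide), fun _ => hf ⟨7, by norm_num⟩ (by norm_num)⟩
  · exact ⟨fun h => absurd h (by decide), fun _ => hf ⟨8, by norm_num⟩ (by norm_num)⟩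
  · exact ⟨fun h => absurd h (by decide), fun _ => hf ⟨9, by norm_num⟩ (by norm_num)⟩
  · exact ⟨fun h => absurd h (by decide), fun _ => hf ⟨10, by norm_num⟩ (by norm_num)⟩
  · exact ⟨fun h => absurd h (by decide), fun _ => hf ⟨11, by norm_num⟩ (by norm_num)⟩

/-! ### Claim level: the poles of the five-ring claim -/

/-- **Poles of the five-ring census claim.**  If the anchors pass the forcing test and the census
claim holds for the pole constraints, then every admissible tuple `t` whose label `0` is bonded to
`1, …, 5` and far from `6, …, 11` has a second label `k' ≠ 0` of contact degree `5` (the other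
pole of the bicapped pentagonal prism), and every label `k' ≠ 0` of contact degree `5` is NOT
bonded to label `0` (`1 < dist (t 0) (t k')`). -/
theorem poles_of_fiveRingClaim :
    ∀ (η : ℚ) (A : List (List (ℚ × ℚ × ℚ))), bppForcingB η A = true →
      (fiveRingSpec η A).Claim (anchorPatterns η A) (fiveRingConstraints.take 11) →
      ∀ t : Fin 12 → EuclideanSpace ℝ (Fin 3), (fiveRingSpec η A).Admissible t →
        (fiveRingSpec η A).Sat (fiveRingConstraints.take 11) t →
        (∃ k' : Fin 12, k' ≠ 0 ∧
            (Finset.univ.filter fun l : Fin 12 => l ≠ k' ∧ dist (t k') (t l) ≤ 1).card = 5) ∧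
          ∀ k' : Fin 12, k' ≠ 0 →
            (Finset.univ.filter fun l : Fin 12 => l ≠ k' ∧ dist (t k') (t l) ≤ 1).card = 5 →
              1 < dist (t 0) (t k') := by
  intro η A hF hC t ht hS
  obtain ⟨i, hi, hclose⟩ := hC t ht hS
  have hiA : i < A.length := by simpa [anchorPatterns] using hi
  have hpts : (anchorPatterns η A).pts[i] = anchorTuple η A A[i] := by
    simp [anchorPatterns, List.getElem_map]
  rw [hpts] at hclose
  have hrow : A[i] ∈ A := List.getElem_mem hiA
  obtain ⟨σ, hσ⟩ := bond_iff_bppAdj_of_close hF hrow ht hclose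
  -- label `0` has contact degree `≥ 5`, hence `= 5`, hence `σ 0` is a pole
  have h5 : 5 ≤ (univ.filter fun l : Fin 12 => l ≠ 0 ∧ dist (t 0) (t l) ≤ 1).card := by
    have hsub : ({1, 2, 3, 4, 5} : Finset (Fin 12)) ⊆
        (univ.filter fun l : Fin 12 => l ≠ 0 ∧ dist (t 0) (t l) ≤ 1) := by
      intro l hl
      simp only [mem_insert, mem_singleton] at hl
      rw [mem_filter]
      rcases hl with rfl | rfl | rfl | rfl | rfl
      · exact ⟨mem_univ _, by decide, dist_le_one_of_sat hS 1 (by norm_num) (by norm_num)⟩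
      · exact ⟨mem_univ _, by decide, dist_le_one_of_sat hS 2 (by norm_num) (by norm_num)⟩
      · exact ⟨mem_univ _, by decide, dist_le_one_of_sat hS 3 (by norm_num) (by norm_num)⟩
      · exact ⟨mem_univ _, by decide, dist_le_one_of_sat hS 4 (by norm_num) (by norm_num)⟩
      · exact ⟨mem_univ _, by decide, dist_le_one_of_sat hS 5 (by norm_num) (by norm_num)⟩
    have hc5 : ({1, 2, 3, 4, 5} : Finset (Fin 12)).card = 5 := by decide
    exact hc5 ▸ card_le_card hsub
  have hpole0 : σ 0 = 0 ∨ σ 0 = 11 := by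
    have h45 := card_bonded_eq_five_iff hσ 0
    rcases h45.2 with h4 | h5'
    · omega
    · exact h45.1.1 h5'
  refine ⟨?_, ?_⟩
  · -- the other pole
    obtain ⟨p, hp, hp0⟩ : ∃ p : Fin 12, (p = 0 ∨ p = 11) ∧ p ≠ σ 0 := by
      rcases hpole0 with h | h
      · exact ⟨11, Or.inr rfl, by rw [h]; decide⟩
      · exact ⟨0, Or.inl rfl, by rw [h]; decide⟩
    refine ⟨σ.symm p, fun h0 => hp0 (by rw [← h0, Equiv.apply_symm_apply]), ?_⟩
    exact (card_bonded_eq_five_iff hσ (σ.symm p)).1.2 (by simpa using hp)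
  · intro k' hk' hdeg
    have hpk : σ k' = 0 ∨ σ k' = 11 := (card_bonded_eq_five_iff hσ k').1.1 hdeg
    have hne : σ 0 ≠ σ k' := fun h => hk' (σ.injective h).symm
    have hadj : bppAdj (σ 0) (σ k') = false := bpp_poles_not_adj' _ _ hpole0 hpk hne
    have hnot : ¬ dist (t 0) (t k') ≤ 1 := fun h => by
      have := (hσ 0 k' (Ne.symm hk')).1 h
      rw [hadj] at this
      exact Bool.false_ne_true this
    exact lt_of_not_ge hnot

end Summit.AtomisticToContinuum.Crystallization.Theorems.SquareWellLayerCakeGapTwelveToBarlow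

end
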